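import Summits.QuantumFields.YangMills.Theorems.BalabanUVNodesN20KeyedRelWeightAtForgivingKey
import Summits.QuantumFields.YangMills.Theorems.BalabanUVNodesSpineReadingOfRecord13CoPHKForgive

/-!
# BalabanUVNodes ∕ N20 (NE7b) — THE N20 FACE UNDER A THRESHOLD BAD READING ON AN ℕ-VALUED KEY STATISTIC (the SIZE currency): the coarse persistence class `{n K ≤ φ}` is
# the disjoint union of its VALUE strata `{φ = m}`, the canonical fraction obeys `W K ≤ Σ_{m ≥ n K}` per-value fractions, the tail ∕ geometric socket `W K ≤ V·q^{n K}∕(1−q)` and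
# its design rule; instance: the FLOOR-VOLUME statistic `Node00.largeFieldVolume (c K + 1)` at dag-n20-d's NAMED component-forgiving dial `forgiveCompReading₁₃ K₀ c`

Cell `pub-ymgap` (HUMAN RULING D-0062 Track A; work-bound push D-0149, director-ym №197), width seat `pub-ymgap-dag-n20-w2` (gen 4) on node N20 = NE7b; CLAIM-1 of the re-seat
(pub-ymgap INBOX l.32430) = triggers (t4′)∕(t5) of this lineage's g3 HANDOFF: dag-n20-d g29 NAMED the forgiving dial (`Thm/BalabanUVNodesSpineReadingOfRecord13CoPHKForgive`,
p617877: `forgiveCompReading₁₃ K₀ c` = gen 3's lambda by `rfl`) and typed the size STATISTIC `Node00.largeFieldVolume` (`Node00/TwoRunSiteWindow` v1.2 §5, p616671; the floor-volume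
BAD READING itself is dag-n20-d's OFFER (t11)(b), theirs to declare — this file never declares a reading).  Filed `--kind proof --supports stmt-QuantumFields-20544 --as helper`
(K3⁷ `SpineGivenEndpointR13SepCoPH`; skeleton v5 941dddb108cbaacf STANDS — every theorem is about dag-n20-d's reading `crOfRecord₁₃KAt K₀ kr bd sh`, whose identity-dial
instance IS v5's pin); COUNT-NEUTRAL; LOCATED.  [III] = [Balaban1988Convergent], [LF-I] = [Balaban1989LargeFieldI], [LF-II] = [Balaban1989LargeFieldII].

WHY.  Gen 3 priced the N20 weight face through the AGE of a history's first (un-absorbed) large field: the coarse persistence class under a LEVEL cut is the disjoint union of its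
birth-level strata, so `W ≤ Σ_levels` per-stratum fractions and a per-level survival rate `V·r^{age}` gives the face (p606933 ∕ p610465 ∕ p617084).  At a window key the level
cut saturates exactly as level one did (p610465 §4: «cut ≤ floor, eventually»); dag-n20-d's (t11) diagnosis names the next currency — SIZE: at floor `c(K) = K₀ + K − w(K)` the
typical number of large floor blocks is polynomially large, so «non-empty at the floor» saturates, while «the floor-level large-field region has `≥ n(K)` sites» with `n(K)` above
the typical count is a LARGE-DEVIATION event ([LF-II] (1.89) p.387: every large-field cube pays `exp(−p₀(g))`; [LF-I] (0.2) p.176).  This file is the N20 face's pricing socket in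
that currency, for ANY dial `kr` and ANY bad reading of THRESHOLD form `bd K u ⟺ n K ≤ φ K u` on an ℕ-valued key statistic `φ` (no step-preservation needed — the threshold reads
the step argument): the coarse bad class is the disjoint union over the VALUES `m ≥ n K` of the level sets `{φ K · = m}` (§1–§2, exact), so `W K ≤ Σ_{m ≥ n K}` per-value fractions,
and a geometric large-deviation letter «the classes with `φ = m` carry at most the fraction `V·q^m` of each run's mass» gives `W K ≤ V·q^{n K}∕(1−q)` and the face as soon as the
threshold has a floor `n₀` with `V·q^{n₀} < 1 − q` and `Σ_K q^{n K} < ∞` (§3, the design rule — twin of gen 3's `(r, V, a₀, linear age floor)`).  §4 reads it at the floor-volume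
statistic `largeFieldVolume (c K + 1)` at the NAMED forgiving dial (threshold `1` there is gen 3's level cut one above the floor — dag-n20-d's INTENT-4 dictionary; thresholds `n ≥ 1`
cut sub-classes, antitone): the size-currency design rule AT `crOfRecord₁₃KAt K₀ (forgiveCompReading₁₃ K₀ c) (floor-volume ≥ n) sh`, and — the (t4′) twin — gen 3's age-currency design
rule transported to the named dial.
CONTENTS (theorems only; 0 `def`):
* §1 (folklore, any `Finset`) `sum_filter_threshold_eq_sum_fibers` · `sum_filter_threshold_le_of_valueFractions` · `sum_le_tsum_tail_of_forall_le` · `sum_pow_le_geomTail_of_forall_le` ·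
  `geomMajorant_lt_one_of_floor` · `summable_geomThreshold_of_linear`;
* §2 (n20-d's coarse carriers, ANY dial, threshold reading) `badClassK₁₃_congr_on` · `mem_badClassK₁₃_thr_iff` · `badClassK₁₃_thr_eq_filter` · `badClassK₁₃_thr_antitone_at` ·
  `badClassK₁₃_thr_zero_at` (threshold `0` books EVERY coarse class) · `badClassK₁₃_thr_eq_empty_of_forall_lt` · ★★ `sum_badClassK₁₃_thr_eq_sum_values` (EXACT value stratification);
* §3 (the reading `crOfRecord₁₃KAt K₀ kr bd sh` at a tuple where `bd` READS AS a threshold ON THE COARSE CLASS SET: `bd … K u ↔ n K ≤ φ K u`) ★★ `W_crOfRecord₁₃KAt_thr_le_sum_values` · ★★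
  `relWeightBound_crOfRecord₁₃KAt_thr_of_valueFractions` · ★★ `W_crOfRecord₁₃KAt_thr_le_tsum_tail` · ★★ `W_crOfRecord₁₃KAt_thr_le_geometric` · ★★ `relWeightBound_crOfRecord₁₃KAt_thr_of_geometric`
  (THE DESIGN RULE in the size currency) · `relWeightBound_crOfRecord₁₃KAt_thr_of_geometric_linear`;
* §4 (instances at the NAMED forgiving dial) ★★ `relWeightBound_forgiveCompReading₁₃_floorVolume_of_geometric` (the floor-volume reading spelled as dag-n20-d's INTENT-4 spells it, at the
  key's own step — its dictionary, incl. «threshold `1` = the level cut one above the floor», is THEIRS) · `relWeightBound_forgiveCompReading₁₃_of_survival_ageFloor` ((t4′): p617084 §2 at the named dial).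
Cited BY NAME, not re-typed: dag-n20-d `…SpineReadingOfRecord13CoPHK` (`crOfRecord₁₃KAt`, `classSetK₁₃`, `badClassK₁₃`, `weightAK₁₃ ∕ weightBK₁₃`, `mem_badClassK₁₃_iff`,
`badKeyReadingOfCut₁₃`), `…CoPHKForgive` (`forgiveCompReading₁₃`), `Node00/TwoRunSiteWindow` §5 (`largeFieldVolume`), `Node00/TwoRunSiteComponents` (`forgiveKeyCompSigma`),
`…SpineCanonicalWeights` (`wInf_le_of_mem`, `wInf_nonneg`), this seat's `…AtKeyReading` §1 (`relWeightBound_crOfRecord₁₃KAt_iff`,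
`weightAK₁₃_nonneg_of_provisos`), `…AtForgivingKey` §2, dag-n20-w1 `…OverCut` (`fst_eq_of_mem_classSet₁₃`).

HONEST FRAMING.  [folklore] finite-sum ∕ real-analysis bookkeeping BY NAME over dag-n20-d's readings and the tree's SHAPES; every per-value fraction ∕ geometric letter
`Σ_{φ = m} weight ≤ V·q^m·Σ weight` is a HYPOTHESIS — the (AC)-type multi-block large-deviation estimate at a coarse key ([LF-II] (1.89) prints ABSOLUTE per-cube factors; the RELATIVE,
size-indexed letter is the cell's NE7b body in the size currency), NAMED OPEN, NOT PRINTED for `d = 4`, NOT proved, inhabited here for no Bałaban family; NO weight bounded, NO estimate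
proved; whether the floor-volume dial escapes the saturation walls of p597932 ∕ p610465 §4 depends on the threshold's growth against the floor's typical count — NOT decided here.
Nothing of Bałaban's is asserted; NE7 ∕ NE7b ∕ NE7c NOT PRINTED for `d = 4`, NOT proved; (α)-instance 0∕1; no `Provisos₁₃CoPH` inhabitant claimed (K0⁷ OPEN); N19 ∕ N20 ∕ N21 ∕ N27
NOT discharged; K3⁷ NOT closed (v5 stands; no dial ∕ bad reading is pinned by any registered text); counts unmoved (typed 28∕28 · discharged 5∕27); no count claim (the chair's single
count line is the only count).  One finite `𝕋⁴_{L^K}` programme at fixed `ε = L^{−K}`, Bałaban AS PRINTED; the YM mass gap (Clay) is NOT proved by any of this — R4 closes the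
conditional finite-𝕋⁴ rung `BalabanLadder.UV` only; NOT ℝ⁴ ∕ infinite volume ∕ OS.  No `def` ∕ `instance` ∕ `notation` ∕ `sorry`.  Sources (locators only): [LF-II] Thm 1 + (0.1)
pp.355–356, (1.79)–(1.80) pp.383–384, (1.89) p.387; [LF-I] (0.2) p.176; [III] (2.18) p.257, p.244; [King1986] (3.10)–(3.11) p.656.
-/

noncomputable section

open scoped BigOperators
open _root_.Filter _root_.Topology

namespace Summit.QuantumFields.YangMills.BalabanUVNodes.N20KeyedRelWeightValueStrata

open Literature.MathematicalPhysics.QuantumFieldTheory.Balaban1983to89 Literature.MathematicalPhysics.QuantumFieldTheory.Balaban1983to89.Node00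
open T4Continuum
open T4WeightBudget (RelWeightBound)
open YMDAG.UVSplit hiding SU
open Summit.QuantumFields.YangMills.BalabanUVNodes.SpineCanonicalWeights
open Summit.QuantumFields.YangMills.BalabanUVNodes.N20KeyedRelWeightAtKeyReading
open Summit.QuantumFields.YangMills.BalabanUVNodes.N20KeyedRelWeightAtForgivingKey
open Summit.QuantumFields.YangMills.BalabanUVNodes.N20KeyedRelWeightOverCut (fst_eq_of_mem_classSet₁₃)

variable {F : T4Family} {N : ℕ} [NeZero N]

/-! ## §1  Folklore: a threshold class is the disjoint union of its value fibres; tails of a summable ∕ geometric majorant over a finite set of values -/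
section Fibers
variable {ι : Type*} (S : Finset ι) (φ : ι → ℕ) (n : ℕ)

/-- **★ THE VALUE STRATIFICATION OF A THRESHOLD CLASS** (exact): `Σ_{u ∈ S, n ≤ φ u} f u = Σ_{m ∈ φ(S), n ≤ m} Σ_{u ∈ S, φ u = m} f u` — the threshold class is the disjoint union
over the attained values `m ≥ n` of the level sets of the statistic. [cite: Balaban1989LargeFieldII, (1.79)–(1.80) pp.383–384 (bookkeeping)] -/
theorem sum_filter_threshold_eq_sum_fibers (f : ι → ℝ) :
    ∑ u ∈ S.filter (fun u => n ≤ φ u), f u =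
      ∑ m ∈ (S.image φ).filter (fun m => n ≤ m), ∑ u ∈ S.filter (fun u => φ u = m), f u := by
  rw [← Finset.sum_fiberwise_of_maps_to (s := S.filter (fun u => n ≤ φ u)) (t := (S.image φ).filter (fun m => n ≤ m)) (g := φ)
    (fun u hu => Finset.mem_filter.2 ⟨Finset.mem_image_of_mem φ (Finset.mem_filter.1 hu).1, (Finset.mem_filter.1 hu).2⟩)]
  refine Finset.sum_congr rfl fun m hm => Finset.sum_congr ?_ fun _ _ => rfl
  ext u
  simp only [Finset.mem_filter]
  constructor
  · rintro ⟨⟨hu, -⟩, h⟩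
    exact ⟨hu, h⟩
  · rintro ⟨hu, h⟩
    exact ⟨⟨hu, h ▸ (Finset.mem_filter.1 hm).2⟩, h⟩

/-- **PER-VALUE FRACTIONS SUM**: if the level set `{φ = m}` carries at most the fraction `a m` of `Σ_S f` for every value `m ≥ n`, the threshold class carries at most the fraction
`Σ_{m ∈ φ(S), n ≤ m} a m`. [cite: Balaban1989LargeFieldII, (1.80) p.384, (1.89) p.387 (bookkeeping)] -/
theorem sum_filter_threshold_le_of_valueFractions (f : ι → ℝ) {a : ℕ → ℝ}
    (hfrac : ∀ m, n ≤ m → ∑ u ∈ S.filter (fun u => φ u = m), f u ≤ a m * ∑ u ∈ S, f u) :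
    ∑ u ∈ S.filter (fun u => n ≤ φ u), f u ≤ (∑ m ∈ (S.image φ).filter (fun m => n ≤ m), a m) * ∑ u ∈ S, f u := by
  rw [sum_filter_threshold_eq_sum_fibers S φ n f, Finset.sum_mul]
  exact Finset.sum_le_sum fun m hm => hfrac m (Finset.mem_filter.1 hm).2
end Fibers

section Tails
/-- **A FINITE SET OF VALUES `≥ n` SUMS BELOW THE TAIL**: `T ⊆ [n, ∞)` finite, `a ≥ 0` with summable tail ⇒ `Σ_{m ∈ T} a m ≤ Σ' k, a (n + k)`.
[cite: King1986, (3.10)–(3.11) p.656 (bookkeeping)] -/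
theorem sum_le_tsum_tail_of_forall_le {T : Finset ℕ} {n : ℕ} (hT : ∀ m ∈ T, n ≤ m) {a : ℕ → ℝ} (ha : ∀ m, 0 ≤ a m)
    (hs : Summable fun k => a (n + k)) : ∑ m ∈ T, a m ≤ ∑' k, a (n + k) := by
  obtain ⟨M, hM⟩ : ∃ M, ∀ m ∈ T, m < M := ⟨T.sup id + 1, fun m hm => Nat.lt_succ_of_le (Finset.le_sup (f := id) hm)⟩
  calc ∑ m ∈ T, a m ≤ ∑ m ∈ Finset.Ico n M, a m :=
        Finset.sum_le_sum_of_subset_of_nonneg (fun m hm => Finset.mem_Ico.2 ⟨hT m hm, hM m hm⟩) fun m _ _ => ha m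
    _ = ∑ k ∈ Finset.range (M - n), a (n + k) := Finset.sum_Ico_eq_sum_range a n M
    _ ≤ ∑' k, a (n + k) := hs.sum_le_tsum _ fun k _ => ha (n + k)

/-- **THE GEOMETRIC TAIL OVER A FINITE SET OF VALUES `≥ n`**: `Σ_{m ∈ T} q^m ≤ q^n∕(1−q)` for `0 ≤ q < 1`. [cite: King1986, (3.10)–(3.11) p.656 (bookkeeping)] -/
theorem sum_pow_le_geomTail_of_forall_le {T : Finset ℕ} {n : ℕ} (hT : ∀ m ∈ T, n ≤ m) {q : ℝ} (h0 : 0 ≤ q) (h1 : q < 1) :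
    ∑ m ∈ T, q ^ m ≤ q ^ n / (1 - q) := by
  obtain ⟨M, hM⟩ : ∃ M, ∀ m ∈ T, m < M := ⟨T.sup id + 1, fun m hm => Nat.lt_succ_of_le (Finset.le_sup (f := id) hm)⟩
  calc ∑ m ∈ T, q ^ m ≤ ∑ m ∈ Finset.Ico n M, q ^ m :=
        Finset.sum_le_sum_of_subset_of_nonneg (fun m hm => Finset.mem_Ico.2 ⟨hT m hm, hM m hm⟩) fun m _ _ => pow_nonneg h0 m
    _ ≤ q ^ n / (1 - q) := geom_sum_Ico_le_of_lt_one h0 h1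

/-- **THE GEOMETRIC MAJORANT IS `< 1` FROM A THRESHOLD FLOOR**: `V·q^{n₀} < 1 − q` and `n₀ ≤ n` ⇒ `V·q^n∕(1−q) < 1`. [cite: King1986, (3.10)–(3.11) p.656 (bookkeeping)] -/
theorem geomMajorant_lt_one_of_floor {q V : ℝ} {n₀ n : ℕ} (h0 : 0 ≤ q) (h1 : q < 1) (hV : 0 ≤ V) (hthr : V * q ^ n₀ < 1 - q) (hn : n₀ ≤ n) :
    V * q ^ n / (1 - q) < 1 := by
  rw [div_lt_one (sub_pos.2 h1)]
  exact (mul_le_mul_of_nonneg_left (pow_le_pow_of_le_one h0 h1.le hn) hV).trans_lt hthr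

/-- **SUMMABILITY OVER THE STEPS FROM A LINEARLY GROWING THRESHOLD**: `c·K ≤ n K` (`c > 0`), `0 < q < 1`, `0 ≤ V` ⇒ `K ↦ V·q^{n K}` summable (gen 3's `summable_ageMajorant_of_linearAge`
argument in the size currency). [cite: King1986, (3.10)–(3.11) p.656 (bookkeeping)] -/
theorem summable_geomThreshold_of_linear {q V c : ℝ} (h0 : 0 < q) (h1 : q < 1) (hV : 0 ≤ V) (hc : 0 < c) {n : ℕ → ℕ}
    (hlin : ∀ K : ℕ, c * K ≤ (n K : ℝ)) : Summable fun K => V * q ^ n K := by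
  have hqc0 : 0 ≤ q ^ c := Real.rpow_nonneg h0.le c
  have hqc1 : q ^ c < 1 := Real.rpow_lt_one h0.le h1 hc
  have key : ∀ K : ℕ, q ^ n K ≤ (q ^ c) ^ K := by
    intro K
    rw [← Real.rpow_natCast q (n K), ← Real.rpow_natCast (q ^ c) K, ← Real.rpow_mul h0.le]
    exact Real.rpow_le_rpow_of_exponent_ge h0 h1.le (hlin K)
  exact Summable.of_nonneg_of_le (fun K => mul_nonneg hV (pow_nonneg h0.le _))
    (fun K => mul_le_mul_of_nonneg_left (key K) hV) ((summable_geometric_of_lt_one hqc0 hqc1).mul_left V)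
end Tails

/-! ## §2  At dag-n20-d's coarse carriers, ANY dial: the coarse bad class of a THRESHOLD reading and its value strata -/
section Threshold
variable (θ : Stage13HParams F N) (K₀ : ℕ) (g₀ : ℕ → ℝ) (kr : ℕ → (Σ K, SiteSeqKey F (K₀ + K)) → (Σ K, SiteSeqKey F (K₀ + K)))

/-- **TWO BAD-KEY READINGS THAT AGREE ON THE COARSE CLASS SET SELECT THE SAME COARSE BAD CLASS** (so a NAMED threshold reading — e.g. one reading the threshold at the key's own
step `u.1` — and an ambient-step lambda spelling are interchangeable below whenever they agree on `classSetK₁₃ … K`). [cite: Balaban1989LargeFieldII, (1.80) p.384 (bookkeeping)] -/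
theorem badClassK₁₃_congr_on {bd bd' : ℕ → (Σ K, SiteSeqKey F (K₀ + K)) → Prop} {K : ℕ} (h : ∀ u ∈ classSetK₁₃ θ K₀ g₀ kr K, (bd K u ↔ bd' K u)) (t : ℝ) :
    badClassK₁₃ θ K₀ g₀ kr bd K t = badClassK₁₃ θ K₀ g₀ kr bd' K t := by
  ext u
  rw [mem_badClassK₁₃_iff, mem_badClassK₁₃_iff]
  exact ⟨fun hu => ⟨hu.1, (h u hu.1).1 hu.2⟩, fun hu => ⟨hu.1, (h u hu.1).2 hu.2⟩⟩

variable (φ : ℕ → (Σ K, SiteSeqKey F (K₀ + K)) → ℕ)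

/-- **MEMBERSHIP UNDER A THRESHOLD READING** `bd K u := n K ≤ φ K u`: a coarse class whose statistic at the step is at least the threshold. [cite: Balaban1989LargeFieldII, (1.80) p.384 (bookkeeping)] -/
theorem mem_badClassK₁₃_thr_iff (n : ℕ → ℕ) (K : ℕ) (t : ℝ) (u : Σ K, SiteSeqKey F (K₀ + K)) :
    u ∈ badClassK₁₃ θ K₀ g₀ kr (fun K u => n K ≤ φ K u) K t ↔ u ∈ classSetK₁₃ θ K₀ g₀ kr K ∧ n K ≤ φ K u :=
  mem_badClassK₁₃_iff θ K₀ g₀ kr _ K t u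

/-- The threshold class as a decidable filter of the coarse class set. [cite: Balaban1989LargeFieldII, (1.80) p.384 (bookkeeping)] -/
theorem badClassK₁₃_thr_eq_filter (n : ℕ → ℕ) (K : ℕ) (t : ℝ) :
    badClassK₁₃ θ K₀ g₀ kr (fun K u => n K ≤ φ K u) K t = (classSetK₁₃ θ K₀ g₀ kr K).filter (fun u => n K ≤ φ K u) := by
  ext u
  rw [mem_badClassK₁₃_thr_iff, Finset.mem_filter]

/-- **ANTITONE IN THE THRESHOLD** (at one step): a higher threshold selects a sub-class. [cite: Balaban1989LargeFieldII, (1.80) p.384 (bookkeeping)] -/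
theorem badClassK₁₃_thr_antitone_at {n n' : ℕ → ℕ} {K : ℕ} (h : n K ≤ n' K) (t : ℝ) :
    badClassK₁₃ θ K₀ g₀ kr (fun K u => n' K ≤ φ K u) K t ⊆ badClassK₁₃ θ K₀ g₀ kr (fun K u => n K ≤ φ K u) K t := by
  intro u hu
  rw [mem_badClassK₁₃_thr_iff] at hu ⊢
  exact ⟨hu.1, h.trans hu.2⟩

/-- **THRESHOLD `0` BOOKS EVERY COARSE CLASS** (the over-cut end's twin: then `RelWeightBound` asks the whole keyed mass to be a fraction `< 1` of itself).
[cite: Balaban1989LargeFieldII, (1.80) p.384 (bookkeeping)] -/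
theorem badClassK₁₃_thr_zero_at {n : ℕ → ℕ} {K : ℕ} (h : n K = 0) (t : ℝ) :
    badClassK₁₃ θ K₀ g₀ kr (fun K u => n K ≤ φ K u) K t = classSetK₁₃ θ K₀ g₀ kr K := by
  ext u
  rw [mem_badClassK₁₃_thr_iff, h]
  exact ⟨fun hu => hu.1, fun hu => ⟨hu, Nat.zero_le _⟩⟩

/-- **A THRESHOLD ABOVE EVERY ATTAINED VALUE BOOKS NOTHING** at that step. [cite: Balaban1989LargeFieldII, (1.80) p.384 (bookkeeping)] -/
theorem badClassK₁₃_thr_eq_empty_of_forall_lt {n : ℕ → ℕ} {K : ℕ} (h : ∀ u ∈ classSetK₁₃ θ K₀ g₀ kr K, φ K u < n K) (t : ℝ) :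
    badClassK₁₃ θ K₀ g₀ kr (fun K u => n K ≤ φ K u) K t = ∅ := by
  refine Finset.eq_empty_of_forall_notMem fun u hu => ?_
  rw [mem_badClassK₁₃_thr_iff] at hu
  exact absurd hu.2 (not_le.2 (h u hu.1))

/-- **★★ THE VALUE STRATIFICATION OF THE COARSE PERSISTENCE CLASS OF A THRESHOLD READING** (any dial, any statistic, exact): at every step `K` and source `t`,
`Σ_{u ∈ badClassK₁₃ … (n ≤ φ) K t} f u = Σ_{m ∈ φ K (classSetK₁₃ … K), n K ≤ m} Σ_{u ∈ classSetK₁₃ … K, φ K u = m} f u`.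
[cite: Balaban1989LargeFieldII, (1.79)–(1.80) pp.383–384, (1.89) p.387 (bookkeeping)] -/
theorem sum_badClassK₁₃_thr_eq_sum_values (n : ℕ → ℕ) (K : ℕ) (t : ℝ) (f : (Σ K, SiteSeqKey F (K₀ + K)) → ℝ) :
    ∑ u ∈ badClassK₁₃ θ K₀ g₀ kr (fun K u => n K ≤ φ K u) K t, f u =
      ∑ m ∈ ((classSetK₁₃ θ K₀ g₀ kr K).image (φ K)).filter (fun m => n K ≤ m),
        ∑ u ∈ (classSetK₁₃ θ K₀ g₀ kr K).filter (fun u => φ K u = m), f u := by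
  rw [badClassK₁₃_thr_eq_filter]
  exact sum_filter_threshold_eq_sum_fibers _ (φ K) (n K) f
end Threshold

/-! ## §3  The sockets at the reading `crOfRecord₁₃KAt K₀ kr bd sh` whose bad reading READS AS a threshold on the coarse class set at the tuple -/
section Sockets
variable (θ : Stage13HParams F N) (hP : θ.Provisos₁₃CoPH F N) (K₀ : ℕ) (g₀ : ℕ → ℝ) (os : List (ULoop F)) (krR : KeyReading₁₃ N K₀) (bdR : BadKeyReading₁₃ N K₀)
  (sh : ShellSplit₁₃CoPH N K₀) (φ : ℕ → (Σ K, SiteSeqKey F (K₀ + K)) → ℕ) (n : ℕ → ℕ)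
  (hbd : ∀ K, ∀ u ∈ classSetK₁₃ θ K₀ g₀ (krR F θ hP g₀ os) K, (bdR F θ hP g₀ os K u ↔ n K ≤ φ K u))
include hbd
/-- **★★ THE READING's FRACTION IS AT MOST THE SUM OF THE PER-VALUE FRACTIONS** (any dial; the bad reading reads as `n K ≤ φ K ·` at the tuple): per-value relative bounds
`a m K ≥ 0` (run A) ∕ `b m K` (run B) at the COARSE carriers for the attained values `m ≥ n K`, `|t| ≤ 1` ⇒ `(crOfRecord₁₃KAt K₀ kr bd sh …).W K ≤ Σ_{m ∈ values, n K ≤ m} max (a m K) (b m K)`.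
[cite: Balaban1989LargeFieldII, (1.80) p.384, (1.89) p.387; King1986, (3.10)–(3.11) p.656 (bookkeeping)] -/
theorem W_crOfRecord₁₃KAt_thr_le_sum_values {a b : ℕ → ℕ → ℝ} (K : ℕ) (ha : ∀ m, n K ≤ m → 0 ≤ a m K)
    (hA : ∀ t : ℝ, |t| ≤ 1 → ∀ m, n K ≤ m →
      ∑ u ∈ (classSetK₁₃ θ K₀ g₀ (krR F θ hP g₀ os) K).filter (fun u => φ K u = m), weightAK₁₃ θ hP K₀ g₀ os (krR F θ hP g₀ os) K t u ≤
        a m K * ∑ u ∈ classSetK₁₃ θ K₀ g₀ (krR F θ hP g₀ os) K, weightAK₁₃ θ hP K₀ g₀ os (krR F θ hP g₀ os) K t u)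
    (hB : ∀ t : ℝ, |t| ≤ 1 → ∀ m, n K ≤ m →
      ∑ u ∈ (classSetK₁₃ θ K₀ g₀ (krR F θ hP g₀ os) K).filter (fun u => φ K u = m), weightBK₁₃ θ hP K₀ g₀ os (krR F θ hP g₀ os) K t u ≤
        b m K * ∑ u ∈ classSetK₁₃ θ K₀ g₀ (krR F θ hP g₀ os) K, weightBK₁₃ θ hP K₀ g₀ os (krR F θ hP g₀ os) K t u) :
    (crOfRecord₁₃KAt K₀ krR bdR sh F θ hP g₀ os).W K ≤
      ∑ m ∈ ((classSetK₁₃ θ K₀ g₀ (krR F θ hP g₀ os) K).image (φ K)).filter (fun m => n K ≤ m), max (a m K) (b m K) := by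
  have hcl : ∀ t : ℝ, badClassK₁₃ θ K₀ g₀ (krR F θ hP g₀ os) (bdR F θ hP g₀ os) K t = badClassK₁₃ θ K₀ g₀ (krR F θ hP g₀ os) (fun K u => n K ≤ φ K u) K t :=
    fun t => badClassK₁₃_congr_on θ K₀ g₀ (krR F θ hP g₀ os) (hbd K) t
  refine wInf_le_of_mem ⟨Finset.sum_nonneg fun m hm => (ha m (Finset.mem_filter.1 hm).2).trans (le_max_left _ _), fun t ht => ⟨?_, ?_⟩⟩
  · show ∑ u ∈ badClassK₁₃ θ K₀ g₀ (krR F θ hP g₀ os) (bdR F θ hP g₀ os) K t, weightAK₁₃ θ hP K₀ g₀ os (krR F θ hP g₀ os) K t u ≤ _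
    rw [hcl t, sum_badClassK₁₃_thr_eq_sum_values θ K₀ g₀ (krR F θ hP g₀ os) φ n K t, Finset.sum_mul]
    exact Finset.sum_le_sum fun m hm => (hA t ht m (Finset.mem_filter.1 hm).2).trans
      (mul_le_mul_of_nonneg_right (le_max_left _ _) (Finset.sum_nonneg fun u _ => weightAK₁₃_nonneg_of_provisos θ hP K₀ g₀ os (krR F θ hP g₀ os) K t u))
  · show ∑ u ∈ badClassK₁₃ θ K₀ g₀ (krR F θ hP g₀ os) (bdR F θ hP g₀ os) K t, weightBK₁₃ θ hP K₀ g₀ os (krR F θ hP g₀ os) K t u ≤ _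
    rw [hcl t, sum_badClassK₁₃_thr_eq_sum_values θ K₀ g₀ (krR F θ hP g₀ os) φ n K t, Finset.sum_mul]
    exact Finset.sum_le_sum fun m hm => (hB t ht m (Finset.mem_filter.1 hm).2).trans
      (mul_le_mul_of_nonneg_right (le_max_right _ _) (Finset.sum_nonneg fun u _ => weightBK₁₃_nonneg_of_provisos θ hP K₀ g₀ os (krR F θ hP g₀ os) K t u))

/-- **★★ N20 AT THE READING FROM PER-VALUE BUDGETS**: per-value relative bounds at every step whose value sums are `< 1` and summable over the steps ⇒ `RelWeightBound` AT
`crOfRecord₁₃KAt K₀ kr bd sh F θ hP g₀ os` with its canonical `W` (`…AtKeyReading` §1 ★★).  The per-value bounds are NE7b's body at the coarse key in the size currency — NAMED OPEN.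
[cite: Balaban1989LargeFieldII, Thm 1 + (0.1) pp.355–356, (1.80) p.384, (1.89) p.387; King1986, (3.10)–(3.11) p.656 (bookkeeping)] -/
theorem relWeightBound_crOfRecord₁₃KAt_thr_of_valueFractions {a b : ℕ → ℕ → ℝ} (ha : ∀ K m, n K ≤ m → 0 ≤ a m K)
    (hA : ∀ (K : ℕ) (t : ℝ), |t| ≤ 1 → ∀ m, n K ≤ m →
      ∑ u ∈ (classSetK₁₃ θ K₀ g₀ (krR F θ hP g₀ os) K).filter (fun u => φ K u = m), weightAK₁₃ θ hP K₀ g₀ os (krR F θ hP g₀ os) K t u ≤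
        a m K * ∑ u ∈ classSetK₁₃ θ K₀ g₀ (krR F θ hP g₀ os) K, weightAK₁₃ θ hP K₀ g₀ os (krR F θ hP g₀ os) K t u)
    (hB : ∀ (K : ℕ) (t : ℝ), |t| ≤ 1 → ∀ m, n K ≤ m →
      ∑ u ∈ (classSetK₁₃ θ K₀ g₀ (krR F θ hP g₀ os) K).filter (fun u => φ K u = m), weightBK₁₃ θ hP K₀ g₀ os (krR F θ hP g₀ os) K t u ≤
        b m K * ∑ u ∈ classSetK₁₃ θ K₀ g₀ (krR F θ hP g₀ os) K, weightBK₁₃ θ hP K₀ g₀ os (krR F θ hP g₀ os) K t u)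
    (hlt : ∀ K, ∑ m ∈ ((classSetK₁₃ θ K₀ g₀ (krR F θ hP g₀ os) K).image (φ K)).filter (fun m => n K ≤ m), max (a m K) (b m K) < 1)
    (hsum : Summable fun K => ∑ m ∈ ((classSetK₁₃ θ K₀ g₀ (krR F θ hP g₀ os) K).image (φ K)).filter (fun m => n K ≤ m), max (a m K) (b m K)) :
    RelWeightBound (crOfRecord₁₃KAt K₀ krR bdR sh F θ hP g₀ os).l₀ (crOfRecord₁₃KAt K₀ krR bdR sh F θ hP g₀ os).T (crOfRecord₁₃KAt K₀ krR bdR sh F θ hP g₀ os).A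
      (crOfRecord₁₃KAt K₀ krR bdR sh F θ hP g₀ os).B (crOfRecord₁₃KAt K₀ krR bdR sh F θ hP g₀ os).Bad (crOfRecord₁₃KAt K₀ krR bdR sh F θ hP g₀ os).W := by
  have hle : ∀ K, (crOfRecord₁₃KAt K₀ krR bdR sh F θ hP g₀ os).W K ≤
      ∑ m ∈ ((classSetK₁₃ θ K₀ g₀ (krR F θ hP g₀ os) K).image (φ K)).filter (fun m => n K ≤ m), max (a m K) (b m K) := fun K =>
    W_crOfRecord₁₃KAt_thr_le_sum_values θ hP K₀ g₀ os krR bdR sh φ n hbd K (ha K) (hA K) (hB K)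
  exact (relWeightBound_crOfRecord₁₃KAt_iff θ hP K₀ g₀ os krR bdR sh).2
    ⟨fun K => (hle K).trans_lt (hlt K), Summable.of_nonneg_of_le (fun K => wInf_nonneg K) hle hsum⟩

/-- **★★ THE TAIL SOCKET**: a common per-value majorant `c m K ≥ 0` for both runs with summable tail ⇒ `W K ≤ Σ' k, c (n K + k) K` — only the values AT OR ABOVE the threshold are paid for.
[cite: Balaban1989LargeFieldII, (1.80) p.384, (1.89) p.387; King1986, (3.10)–(3.11) p.656 (bookkeeping)] -/
theorem W_crOfRecord₁₃KAt_thr_le_tsum_tail {c : ℕ → ℕ → ℝ} (K : ℕ) (hc : ∀ m, 0 ≤ c m K) (hs : Summable fun k => c (n K + k) K)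
    (hA : ∀ t : ℝ, |t| ≤ 1 → ∀ m, n K ≤ m →
      ∑ u ∈ (classSetK₁₃ θ K₀ g₀ (krR F θ hP g₀ os) K).filter (fun u => φ K u = m), weightAK₁₃ θ hP K₀ g₀ os (krR F θ hP g₀ os) K t u ≤
        c m K * ∑ u ∈ classSetK₁₃ θ K₀ g₀ (krR F θ hP g₀ os) K, weightAK₁₃ θ hP K₀ g₀ os (krR F θ hP g₀ os) K t u)
    (hB : ∀ t : ℝ, |t| ≤ 1 → ∀ m, n K ≤ m →
      ∑ u ∈ (classSetK₁₃ θ K₀ g₀ (krR F θ hP g₀ os) K).filter (fun u => φ K u = m), weightBK₁₃ θ hP K₀ g₀ os (krR F θ hP g₀ os) K t u ≤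
        c m K * ∑ u ∈ classSetK₁₃ θ K₀ g₀ (krR F θ hP g₀ os) K, weightBK₁₃ θ hP K₀ g₀ os (krR F θ hP g₀ os) K t u) :
    (crOfRecord₁₃KAt K₀ krR bdR sh F θ hP g₀ os).W K ≤ ∑' k, c (n K + k) K := by
  refine (W_crOfRecord₁₃KAt_thr_le_sum_values θ hP K₀ g₀ os krR bdR sh φ n hbd (a := c) (b := c) K (fun m _ => hc m) hA hB).trans ?_
  simp only [max_self]
  exact sum_le_tsum_tail_of_forall_le (fun m hm => (Finset.mem_filter.1 hm).2) (fun m => hc m) hs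

/-- **★★ THE GEOMETRIC (LARGE-DEVIATION) SOCKET**: the level set `{φ K · = m}` carries at most the fraction `V·q^m` of each run's keyed mass (`0 ≤ q < 1`, `V ≥ 0`), `|t| ≤ 1`,
`m ≥ n K` ⇒ `W K ≤ V·q^{n K}∕(1−q)`. [cite: Balaban1989LargeFieldII, (1.89) p.387, (1.80) p.384; Balaban1989LargeFieldI, (0.2) p.176; King1986, (3.10)–(3.11) p.656 (bookkeeping)] -/
theorem W_crOfRecord₁₃KAt_thr_le_geometric {q V : ℝ} (h0 : 0 ≤ q) (h1 : q < 1) (hV : 0 ≤ V) (K : ℕ)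
    (hA : ∀ t : ℝ, |t| ≤ 1 → ∀ m, n K ≤ m →
      ∑ u ∈ (classSetK₁₃ θ K₀ g₀ (krR F θ hP g₀ os) K).filter (fun u => φ K u = m), weightAK₁₃ θ hP K₀ g₀ os (krR F θ hP g₀ os) K t u ≤
        V * q ^ m * ∑ u ∈ classSetK₁₃ θ K₀ g₀ (krR F θ hP g₀ os) K, weightAK₁₃ θ hP K₀ g₀ os (krR F θ hP g₀ os) K t u)
    (hB : ∀ t : ℝ, |t| ≤ 1 → ∀ m, n K ≤ m →
      ∑ u ∈ (classSetK₁₃ θ K₀ g₀ (krR F θ hP g₀ os) K).filter (fun u => φ K u = m), weightBK₁₃ θ hP K₀ g₀ os (krR F θ hP g₀ os) K t u ≤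
        V * q ^ m * ∑ u ∈ classSetK₁₃ θ K₀ g₀ (krR F θ hP g₀ os) K, weightBK₁₃ θ hP K₀ g₀ os (krR F θ hP g₀ os) K t u) :
    (crOfRecord₁₃KAt K₀ krR bdR sh F θ hP g₀ os).W K ≤ V * q ^ n K / (1 - q) := by
  refine (W_crOfRecord₁₃KAt_thr_le_sum_values θ hP K₀ g₀ os krR bdR sh φ n hbd (a := fun m _ => V * q ^ m) (b := fun m _ => V * q ^ m) K
    (fun m _ => mul_nonneg hV (pow_nonneg h0 m)) hA hB).trans ?_
  simp only [max_self]
  rw [← Finset.mul_sum, mul_div_assoc]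
  exact mul_le_mul_of_nonneg_left (sum_pow_le_geomTail_of_forall_le (fun m hm => (Finset.mem_filter.1 hm).2) h0 h1) hV

/-- **★★ N20 AT THE READING FROM A GEOMETRIC LARGE-DEVIATION LETTER — THE DESIGN RULE IN THE SIZE CURRENCY**: rate `0 < q < 1`, entropy `V ≥ 0`, a THRESHOLD FLOOR `n₀ ≤ n K` with
`V·q^{n₀} < 1 − q`, `Σ_K V·q^{n K} < ∞`, and the per-value geometric domination at the COARSE carriers in both runs ⇒ `RelWeightBound` AT `crOfRecord₁₃KAt K₀ kr bd sh F θ hP g₀ os`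
with its canonical `W`.  The letter is the hypothesis — NE7b's body at the coarse key in the size currency, NAMED OPEN.
[cite: Balaban1989LargeFieldII, Thm 1 + (0.1) pp.355–356, (1.80) p.384, (1.89) p.387; Balaban1989LargeFieldI, (0.2) p.176; King1986, (3.10)–(3.11) p.656 (bookkeeping)] -/
theorem relWeightBound_crOfRecord₁₃KAt_thr_of_geometric {q V : ℝ} {n₀ : ℕ} (h0 : 0 < q) (h1 : q < 1) (hV : 0 ≤ V) (hthr : V * q ^ n₀ < 1 - q)
    (hfloor : ∀ K, n₀ ≤ n K) (hsum : Summable fun K => V * q ^ n K)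
    (hA : ∀ (K : ℕ) (t : ℝ), |t| ≤ 1 → ∀ m, n K ≤ m →
      ∑ u ∈ (classSetK₁₃ θ K₀ g₀ (krR F θ hP g₀ os) K).filter (fun u => φ K u = m), weightAK₁₃ θ hP K₀ g₀ os (krR F θ hP g₀ os) K t u ≤
        V * q ^ m * ∑ u ∈ classSetK₁₃ θ K₀ g₀ (krR F θ hP g₀ os) K, weightAK₁₃ θ hP K₀ g₀ os (krR F θ hP g₀ os) K t u)
    (hB : ∀ (K : ℕ) (t : ℝ), |t| ≤ 1 → ∀ m, n K ≤ m →
      ∑ u ∈ (classSetK₁₃ θ K₀ g₀ (krR F θ hP g₀ os) K).filter (fun u => φ K u = m), weightBK₁₃ θ hP K₀ g₀ os (krR F θ hP g₀ os) K t u ≤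
        V * q ^ m * ∑ u ∈ classSetK₁₃ θ K₀ g₀ (krR F θ hP g₀ os) K, weightBK₁₃ θ hP K₀ g₀ os (krR F θ hP g₀ os) K t u) :
    RelWeightBound (crOfRecord₁₃KAt K₀ krR bdR sh F θ hP g₀ os).l₀ (crOfRecord₁₃KAt K₀ krR bdR sh F θ hP g₀ os).T (crOfRecord₁₃KAt K₀ krR bdR sh F θ hP g₀ os).A
      (crOfRecord₁₃KAt K₀ krR bdR sh F θ hP g₀ os).B (crOfRecord₁₃KAt K₀ krR bdR sh F θ hP g₀ os).Bad (crOfRecord₁₃KAt K₀ krR bdR sh F θ hP g₀ os).W := by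
  have hle : ∀ K, (crOfRecord₁₃KAt K₀ krR bdR sh F θ hP g₀ os).W K ≤ V * q ^ n K / (1 - q) := fun K =>
    W_crOfRecord₁₃KAt_thr_le_geometric θ hP K₀ g₀ os krR bdR sh φ n hbd h0.le h1 hV K (hA K) (hB K)
  refine (relWeightBound_crOfRecord₁₃KAt_iff θ hP K₀ g₀ os krR bdR sh).2 ⟨fun K => (hle K).trans_lt ?_, ?_⟩
  · exact geomMajorant_lt_one_of_floor h0.le h1 hV hthr (hfloor K)
  · exact Summable.of_nonneg_of_le (fun K => wInf_nonneg K) hle (hsum.div_const (1 - q))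

/-- **… with a LINEARLY GROWING THRESHOLD** `c·K ≤ n K` (`c > 0`) supplying the summability over the steps. [cite: Balaban1989LargeFieldII, Thm 1 + (0.1) pp.355–356, (1.89) p.387; King1986, (3.10)–(3.11) p.656 (bookkeeping)] -/
theorem relWeightBound_crOfRecord₁₃KAt_thr_of_geometric_linear {q V c : ℝ} {n₀ : ℕ} (h0 : 0 < q) (h1 : q < 1) (hV : 0 ≤ V) (hc : 0 < c)
    (hthr : V * q ^ n₀ < 1 - q) (hfloor : ∀ K, n₀ ≤ n K) (hlin : ∀ K : ℕ, c * K ≤ (n K : ℝ))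
    (hA : ∀ (K : ℕ) (t : ℝ), |t| ≤ 1 → ∀ m, n K ≤ m →
      ∑ u ∈ (classSetK₁₃ θ K₀ g₀ (krR F θ hP g₀ os) K).filter (fun u => φ K u = m), weightAK₁₃ θ hP K₀ g₀ os (krR F θ hP g₀ os) K t u ≤
        V * q ^ m * ∑ u ∈ classSetK₁₃ θ K₀ g₀ (krR F θ hP g₀ os) K, weightAK₁₃ θ hP K₀ g₀ os (krR F θ hP g₀ os) K t u)
    (hB : ∀ (K : ℕ) (t : ℝ), |t| ≤ 1 → ∀ m, n K ≤ m →
      ∑ u ∈ (classSetK₁₃ θ K₀ g₀ (krR F θ hP g₀ os) K).filter (fun u => φ K u = m), weightBK₁₃ θ hP K₀ g₀ os (krR F θ hP g₀ os) K t u ≤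
        V * q ^ m * ∑ u ∈ classSetK₁₃ θ K₀ g₀ (krR F θ hP g₀ os) K, weightBK₁₃ θ hP K₀ g₀ os (krR F θ hP g₀ os) K t u) :
    RelWeightBound (crOfRecord₁₃KAt K₀ krR bdR sh F θ hP g₀ os).l₀ (crOfRecord₁₃KAt K₀ krR bdR sh F θ hP g₀ os).T (crOfRecord₁₃KAt K₀ krR bdR sh F θ hP g₀ os).A
      (crOfRecord₁₃KAt K₀ krR bdR sh F θ hP g₀ os).B (crOfRecord₁₃KAt K₀ krR bdR sh F θ hP g₀ os).Bad (crOfRecord₁₃KAt K₀ krR bdR sh F θ hP g₀ os).W :=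
  relWeightBound_crOfRecord₁₃KAt_thr_of_geometric θ hP K₀ g₀ os krR bdR sh φ n hbd h0 h1 hV hthr hfloor (summable_geomThreshold_of_linear h0 h1 hV hc hlin) hA hB
end Sockets

/-! ## §4  Instances at dag-n20-d's NAMED component-forgiving dial `forgiveCompReading₁₃ K₀ c` with the FLOOR-VOLUME statistic `largeFieldVolume (c · + 1)` -/
section FloorVolume
variable (θ : Stage13HParams F N) (hP : θ.Provisos₁₃CoPH F N) (K₀ : ℕ) (g₀ : ℕ → ℝ) (os : List (ULoop F)) (cR nR : FloorReading₁₃ N) (sh : ShellSplit₁₃CoPH N K₀)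

/-- **★★ THE SIZE-CURRENCY DESIGN RULE AT THE NAMED FORGIVING DIAL WITH THE FLOOR-VOLUME READING** «the large-field region one above the floor of the FORGIVEN key has `≥ nR … K` finest
sites» — spelled as dag-n20-d's INTENT-4 spells it (threshold and floor read at the key's OWN step `x.1`, `fun … _ x ↦ nR … x.1 ≤ largeFieldVolume (cR … x.1 + 1) x.2`, so their
`badKeyReadingOfFloorVolume₁₃ N K₀ cR nR` re-keys this statement by `rfl`; on the coarse class set `x.1 = K` because the forgiving dial keeps the step): rate `q`, entropy `V`, threshold floor
`n₀` with `V·q^{n₀} < 1 − q`, `Σ_K V·q^{n K} < ∞`, per-volume geometric domination at the coarse carriers ⇒ the N20 face AT `crOfRecord₁₃KAt K₀ (forgiveCompReading₁₃ K₀ cR) (floor-volume ≥ nR) sh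
F θ hP g₀ os`.  HYPOTHESIS = the multi-block large-deviation letter at the window key (NE7b's body in the size currency, NAMED OPEN).  (Threshold `1` here IS gen 3's level cut one above the
floor — dag-n20-d's `bad_forgive_floorVolume_one_eq_cut_succ`, theirs to declare; thresholds above `1` REFINE it, `badClassK₁₃_thr_antitone_at`.)
[cite: Balaban1989LargeFieldII, Thm 1 + (0.1) pp.355–356, (1.79)–(1.80) pp.383–384, (1.89) p.387; Balaban1989LargeFieldI, (0.2) p.176; King1986, (3.10)–(3.11) p.656 (bookkeeping)] -/
theorem relWeightBound_forgiveCompReading₁₃_floorVolume_of_geometric {q V : ℝ} {n₀ : ℕ} (h0 : 0 < q) (h1 : q < 1) (hV : 0 ≤ V) (hthr : V * q ^ n₀ < 1 - q)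
    (hfloor : ∀ K, n₀ ≤ nR F θ hP g₀ os K) (hsum : Summable fun K => V * q ^ nR F θ hP g₀ os K)
    (hA : ∀ (K : ℕ) (t : ℝ), |t| ≤ 1 → ∀ m, nR F θ hP g₀ os K ≤ m →
      ∑ u ∈ (classSetK₁₃ θ K₀ g₀ (forgiveCompReading₁₃ K₀ cR F θ hP g₀ os) K).filter (fun u => largeFieldVolume (cR F θ hP g₀ os K + 1) u.2 = m),
          weightAK₁₃ θ hP K₀ g₀ os (forgiveCompReading₁₃ K₀ cR F θ hP g₀ os) K t u ≤
        V * q ^ m * ∑ u ∈ classSetK₁₃ θ K₀ g₀ (forgiveCompReading₁₃ K₀ cR F θ hP g₀ os) K, weightAK₁₃ θ hP K₀ g₀ os (forgiveCompReading₁₃ K₀ cR F θ hP g₀ os) K t u)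
    (hB : ∀ (K : ℕ) (t : ℝ), |t| ≤ 1 → ∀ m, nR F θ hP g₀ os K ≤ m →
      ∑ u ∈ (classSetK₁₃ θ K₀ g₀ (forgiveCompReading₁₃ K₀ cR F θ hP g₀ os) K).filter (fun u => largeFieldVolume (cR F θ hP g₀ os K + 1) u.2 = m),
          weightBK₁₃ θ hP K₀ g₀ os (forgiveCompReading₁₃ K₀ cR F θ hP g₀ os) K t u ≤
        V * q ^ m * ∑ u ∈ classSetK₁₃ θ K₀ g₀ (forgiveCompReading₁₃ K₀ cR F θ hP g₀ os) K, weightBK₁₃ θ hP K₀ g₀ os (forgiveCompReading₁₃ K₀ cR F θ hP g₀ os) K t u) :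
    RelWeightBound
      (crOfRecord₁₃KAt K₀ (forgiveCompReading₁₃ K₀ cR) (fun F θ hP g₀ os _ x => nR F θ hP g₀ os x.1 ≤ largeFieldVolume (cR F θ hP g₀ os x.1 + 1) x.2) sh F θ hP g₀ os).l₀
      (crOfRecord₁₃KAt K₀ (forgiveCompReading₁₃ K₀ cR) (fun F θ hP g₀ os _ x => nR F θ hP g₀ os x.1 ≤ largeFieldVolume (cR F θ hP g₀ os x.1 + 1) x.2) sh F θ hP g₀ os).T
      (crOfRecord₁₃KAt K₀ (forgiveCompReading₁₃ K₀ cR) (fun F θ hP g₀ os _ x => nR F θ hP g₀ os x.1 ≤ largeFieldVolume (cR F θ hP g₀ os x.1 + 1) x.2) sh F θ hP g₀ os).A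
      (crOfRecord₁₃KAt K₀ (forgiveCompReading₁₃ K₀ cR) (fun F θ hP g₀ os _ x => nR F θ hP g₀ os x.1 ≤ largeFieldVolume (cR F θ hP g₀ os x.1 + 1) x.2) sh F θ hP g₀ os).B
      (crOfRecord₁₃KAt K₀ (forgiveCompReading₁₃ K₀ cR) (fun F θ hP g₀ os _ x => nR F θ hP g₀ os x.1 ≤ largeFieldVolume (cR F θ hP g₀ os x.1 + 1) x.2) sh F θ hP g₀ os).Bad
      (crOfRecord₁₃KAt K₀ (forgiveCompReading₁₃ K₀ cR) (fun F θ hP g₀ os _ x => nR F θ hP g₀ os x.1 ≤ largeFieldVolume (cR F θ hP g₀ os x.1 + 1) x.2) sh F θ hP g₀ os).W := by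
  refine relWeightBound_crOfRecord₁₃KAt_thr_of_geometric θ hP K₀ g₀ os (forgiveCompReading₁₃ K₀ cR) _ sh
    (fun K u => largeFieldVolume (cR F θ hP g₀ os K + 1) u.2) (fun K => nR F θ hP g₀ os K) (fun K u hu => ?_) h0 h1 hV hthr hfloor hsum hA hB
  obtain ⟨K', y⟩ := u
  obtain rfl : K' = K :=
    fst_eq_of_mem_classSetK₁₃ θ K₀ g₀ _ (fun K x hx => forgiveKeyCompSigma_fst_eq θ K₀ g₀ (cR F θ hP g₀ os) K x hx) K hu
  exact Iff.rfl

variable (jcut : ℕ → ℕ) [DecidableEq (Σ K, SiteSeqKey F (K₀ + K))]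

/-- **(t4′) THE AGE-CURRENCY DESIGN RULE AT THE NAMED FORGIVING DIAL** — gen 3's `…AtForgivingKey.relWeightBound_crOfRecord₁₃KAt_forgive_of_survival_ageFloor` (p617084 §2) read at
dag-n20-d's `forgiveCompReading₁₃ K₀ cR` (= gen 3's lambda, `rfl`): survival rate `r`, entropy `V`, minimal age `a₀` with `V·r^{a₀} < 1 − r`, linear age floor, per-birth-level survival
domination of the FORGIVEN strata ⇒ the face AT `crOfRecord₁₃KAt K₀ (forgiveCompReading₁₃ K₀ cR) (badKeyReadingOfCut₁₃ … jcut) sh F θ hP g₀ os`.  Hypothesis = NE7b at the window key (NAMED OPEN).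
[cite: Balaban1989LargeFieldII, Thm 1 + (0.1) pp.355–356, (1.80) p.384, (1.85) p.386, (1.89) p.387; King1986, (3.10)–(3.11) p.656 (bookkeeping)] -/
theorem relWeightBound_forgiveCompReading₁₃_of_survival_ageFloor {r V c : ℝ} {a₀ : ℕ} (h0 : 0 < r) (h1 : r < 1) (hV : 0 ≤ V) (hc : 0 < c)
    (hthr : V * r ^ a₀ < 1 - r) (hwin : ∀ K, jcut K ≤ K₀ + K) (hfloor : ∀ K, a₀ ≤ K₀ + K - jcut K)
    (hfrac : ∀ K : ℕ, c * K ≤ ((K₀ + K - jcut K : ℕ) : ℝ))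
    (hA : ∀ (K : ℕ) (t : ℝ), |t| ≤ 1 → ∀ j < jcut K,
      ∑ u ∈ badClassK₁₃ θ K₀ g₀ (forgiveCompReading₁₃ K₀ cR F θ hP g₀ os) (fun _ x => KeyOldLargeField ((fun _ : ℕ => j + 1) x.1) x.2) K t \
          badClassK₁₃ θ K₀ g₀ (forgiveCompReading₁₃ K₀ cR F θ hP g₀ os) (fun _ x => KeyOldLargeField ((fun _ : ℕ => j) x.1) x.2) K t,
          weightAK₁₃ θ hP K₀ g₀ os (forgiveCompReading₁₃ K₀ cR F θ hP g₀ os) K t u ≤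
        V * r ^ (K₀ + K - (j + 1)) * ∑ u ∈ classSetK₁₃ θ K₀ g₀ (forgiveCompReading₁₃ K₀ cR F θ hP g₀ os) K,
          weightAK₁₃ θ hP K₀ g₀ os (forgiveCompReading₁₃ K₀ cR F θ hP g₀ os) K t u)
    (hB : ∀ (K : ℕ) (t : ℝ), |t| ≤ 1 → ∀ j < jcut K,
      ∑ u ∈ badClassK₁₃ θ K₀ g₀ (forgiveCompReading₁₃ K₀ cR F θ hP g₀ os) (fun _ x => KeyOldLargeField ((fun _ : ℕ => j + 1) x.1) x.2) K t \
          badClassK₁₃ θ K₀ g₀ (forgiveCompReading₁₃ K₀ cR F θ hP g₀ os) (fun _ x => KeyOldLargeField ((fun _ : ℕ => j) x.1) x.2) K t,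
          weightBK₁₃ θ hP K₀ g₀ os (forgiveCompReading₁₃ K₀ cR F θ hP g₀ os) K t u ≤
        V * r ^ (K₀ + K - (j + 1)) * ∑ u ∈ classSetK₁₃ θ K₀ g₀ (forgiveCompReading₁₃ K₀ cR F θ hP g₀ os) K,
          weightBK₁₃ θ hP K₀ g₀ os (forgiveCompReading₁₃ K₀ cR F θ hP g₀ os) K t u) :
    RelWeightBound
      (crOfRecord₁₃KAt K₀ (forgiveCompReading₁₃ K₀ cR) (badKeyReadingOfCut₁₃ N K₀ jcut) sh F θ hP g₀ os).l₀
      (crOfRecord₁₃KAt K₀ (forgiveCompReading₁₃ K₀ cR) (badKeyReadingOfCut₁₃ N K₀ jcut) sh F θ hP g₀ os).T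
      (crOfRecord₁₃KAt K₀ (forgiveCompReading₁₃ K₀ cR) (badKeyReadingOfCut₁₃ N K₀ jcut) sh F θ hP g₀ os).A
      (crOfRecord₁₃KAt K₀ (forgiveCompReading₁₃ K₀ cR) (badKeyReadingOfCut₁₃ N K₀ jcut) sh F θ hP g₀ os).B
      (crOfRecord₁₃KAt K₀ (forgiveCompReading₁₃ K₀ cR) (badKeyReadingOfCut₁₃ N K₀ jcut) sh F θ hP g₀ os).Bad
      (crOfRecord₁₃KAt K₀ (forgiveCompReading₁₃ K₀ cR) (badKeyReadingOfCut₁₃ N K₀ jcut) sh F θ hP g₀ os).W :=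
  relWeightBound_crOfRecord₁₃KAt_forgive_of_survival_ageFloor θ K₀ g₀ hP os cR jcut sh h0 h1 hV hc hthr hwin hfloor hfrac hA hB
end FloorVolume
end Summit.QuantumFields.YangMills.BalabanUVNodes.N20KeyedRelWeightValueStrata

end
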